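import Summits.Ventures.Crystal3D.Theorems.StickyWulffConstantTextureLiminfFluxDrift
import Summits.Ventures.Crystal3D.Theorems.StickyWulffConstantTextureLiminfFluxPolyline
import Summits.Ventures.Crystal3D.Theorems.StickyWulffConstantGenericWallFloorGrainCredits
import HarnessLib

/-!
# The model zigzag POLYLINE of a clamped Barlow plate: vertices are sites, one per layer
# (lane T, flux count F2e; crux `TextureLiminf`, stmt-Ventures-19483)

HONEST FRAMING. Venture `Summits/Ventures/Crystal3D` (cell `crystal3d-full`), helper `--supports` the crux
`TextureLiminf` (stmt-Ventures-19483) of `route-Ventures-StickyWulffConstant`, registered line `TexShadow` (v6.6; cf-p1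
ROUTE.md §86(42) AK: flux count of the per-top walker families, owner wulff-p2).  Rung credit only; F-C1 not moved.

The model zigzag polyline of the plate `(L, s, σ)` toward the cell direction `e` (`zigVertex`: vertex `k` in model layer
`zigLayer k = ±k`, step `zigStep k = modelStep … (zigSlab k)`, `…FluxPolyline`) and its translates by the layer lattice
`ℤu + ℤv` are the walker lines.  Assembling `…FluxChart` (slab volume = `(1/√2)·∫` over the lines), `…FluxLines`/`…FluxDrift`
(weighted length `≤ 1`, cells, drift) and the isometry `w ↦ L w + s`:

* `zigSlab`, `zigLayer`, `zigStep`, `zigFwd`/`zigBwd`, `zigVertex` — the polyline; `zigVertex_succ` — consecutive vertices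
  differ by the step `modelStep … (zigSlab k)`;
* `sub_modelStep_mem_barlowLayer`, `zigVertex_mem_barlowLayer`, `zigVertex_apply_two`, `zigVertex_add_lattice_mem`,
  `zigVertex_add_lattice_mem_stacking` — the polyline and its lattice translates consist of SITES of the stacking, vertex `k`
  in layer `zigLayer k`; `zigStep_spec` — rise `bilayerRise … (zigSlab k)`, unit length, model height `±√(2/3)`.
The count itself (`plate_lines_ge_flux`) is assembled in `…TextureLiminfFluxCount`.
WHAT THIS IS NOT: not the flux count yet, not the walker family; F-C1 not moved.
-/

noncomputable section

namespace Summit.Ventures.Crystal3D.Theorems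

open MeasureTheory Set
open scoped ENNReal InnerProductSpace
open Literature.MathematicalPhysics.StatisticalMechanics (barlowPos barlowLayer barlowStacking constHagg haggLabel
  IsHaggSeq triangularVec₁ triangularVec₂ barlowPos_apply_two)
open Summit.Ventures.Crystal3D.Cruxes.TextureLiminf.TexShadow (E3 stacking laySlab bilayerRise PlateLaunchable plateFlux)

/-! ## The model zigzag polyline of a plate -/

section Polyline

variable (L : E3 ≃ₗᵢ[ℝ] E3) (σ : ℤ → ℤ) (e : E3)

/-- The bilayer traversed at polyline step `k`: `k` if the stacking axis points e-upward, `−k−1` otherwise. -/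
def zigSlab (k : ℤ) : ℤ := if 0 ≤ (L.symm e) 2 then k else -k - 1

/-- The model layer of polyline vertex `k`: `k` resp. `−k`. -/
def zigLayer (k : ℤ) : ℤ := if 0 ≤ (L.symm e) 2 then k else -k

/-- Step `k` of the polyline. -/
def zigStep (k : ℤ) : E3 := modelStep L σ e (zigSlab L e k)

/-- Forward recursion from the origin. -/
def zigFwd : ℕ → E3
  | 0 => 0
  | n + 1 => zigFwd n + zigStep L σ e n

/-- Backward recursion from the origin. -/
def zigBwd : ℕ → E3
  | 0 => 0
  | n + 1 => zigBwd n - zigStep L σ e (-((n : ℤ) + 1))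

/-- **The model zigzag polyline**: vertex `k`. -/
def zigVertex (k : ℤ) : E3 := if 0 ≤ k then zigFwd L σ e k.toNat else zigBwd L σ e (-k).toNat

/-- Vertex `0` is the origin. -/
theorem zigVertex_zero : zigVertex L σ e 0 = 0 := by simp [zigVertex, zigFwd]

/-- **Consecutive vertices differ by the step.** -/
theorem zigVertex_succ (k : ℤ) : zigVertex L σ e (k + 1) = zigVertex L σ e k + zigStep L σ e k := by
  rcases le_or_gt 0 k with hk | hk
  · obtain ⟨n, rfl⟩ := Int.eq_ofNat_of_zero_le hk
    have h1 : ((n : ℤ) + 1).toNat = n + 1 := by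
      rw [show ((n : ℤ) + 1) = ((n + 1 : ℕ) : ℤ) by push_cast; rfl, Int.toNat_natCast]
    simp only [zigVertex, Int.natCast_nonneg, if_true, Int.toNat_natCast,
      show (0 : ℤ) ≤ (n : ℤ) + 1 by positivity, h1, zigFwd]
  · obtain ⟨n, hn⟩ : ∃ n : ℕ, k = -((n : ℤ) + 1) := ⟨(-k - 1).toNat, by omega⟩
    subst hn
    rcases n with _ | n
    · -- `k = -1`
      simp [zigVertex, zigBwd, zigFwd]
    · have h1 : ¬ (0 : ℤ) ≤ -((((n + 1 : ℕ) : ℤ)) + 1) := by push_cast; omega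
      have h2 : ¬ (0 : ℤ) ≤ -((((n + 1 : ℕ) : ℤ)) + 1) + 1 := by push_cast; omega
      have h3 : (-(-((((n + 1 : ℕ) : ℤ)) + 1) + 1)).toNat = n + 1 := by push_cast; omega
      have h4 : (-(-((((n + 1 : ℕ) : ℤ)) + 1))).toNat = n + 2 := by push_cast; omega
      simp only [zigVertex, h1, h2, if_false, h3, h4, zigBwd]
      push_cast
      abel

end Polyline

/-! ## The polyline consists of sites, one per layer -/

section Sites

variable (L : E3 ≃ₗᵢ[ℝ] E3) {σ : ℤ → ℤ} (hσ : IsHaggSeq σ) (e : E3)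

include hσ in
/-- **The step also maps back**: subtracting the step of bilayer `i` maps its e-upper layer to its e-lower layer. -/
theorem sub_modelStep_mem_barlowLayer (i : ℤ) (q : E3) :
    (0 ≤ (L.symm e) 2 → q ∈ barlowLayer 1 (Real.sqrt (2 / 3)) σ (i + 1) →
        q - modelStep L σ e i ∈ barlowLayer 1 (Real.sqrt (2 / 3)) σ i) ∧
    (¬ 0 ≤ (L.symm e) 2 → q ∈ barlowLayer 1 (Real.sqrt (2 / 3)) σ i →
        q - modelStep L σ e i ∈ barlowLayer 1 (Real.sqrt (2 / 3)) σ (i + 1)) := by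
  obtain ⟨-, -, a, b, -, hw⟩ := bestUpSlot_spec L σ e i
  constructor
  · rintro hs ⟨x, y, rfl⟩
    rw [modelStep, axisSign, if_pos hs, one_smul, hw]
    rcases hσ i with h1 | h1
    · rw [if_pos h1]
      refine ⟨x - a, y - b, ?_⟩
      have := barlowPos_add_upSlot σ i h1 (x - a) (y - b) a b
      rw [sub_add_cancel, sub_add_cancel] at this
      rw [← this]; abel
    · rw [if_neg (by rw [h1]; norm_num)]
      refine ⟨x + a, y + b, ?_⟩
      have := barlowPos_add_mirror_upSlot σ i h1 (x + a) (y + b) a b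
      rw [add_sub_cancel_right, add_sub_cancel_right] at this
      rw [← this]; abel
  · rintro hs ⟨x, y, rfl⟩
    rw [modelStep, axisSign, if_neg hs, neg_one_smul, hw, sub_neg_eq_add]
    rcases hσ i with h1 | h1
    · rw [if_pos h1, barlowPos_add_upSlot σ i h1]; exact ⟨_, _, rfl⟩
    · rw [if_neg (by rw [h1]; norm_num), barlowPos_add_mirror_upSlot σ i h1]; exact ⟨_, _, rfl⟩

/-- The origin is a site of layer `0`. -/
theorem zero_mem_barlowLayer_zero' (σ : ℤ → ℤ) : (0 : E3) ∈ barlowLayer 1 (Real.sqrt (2 / 3)) σ 0 :=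
  ⟨0, 0, by simp [barlowPos]⟩

include hσ in
/-- The forward and backward vertices are sites of the expected layers. -/
theorem zigFwd_zigBwd_mem (n : ℕ) :
    zigFwd L σ e n ∈ barlowLayer 1 (Real.sqrt (2 / 3)) σ (zigLayer L e n) ∧
      zigBwd L σ e n ∈ barlowLayer 1 (Real.sqrt (2 / 3)) σ (zigLayer L e (-(n : ℤ))) := by
  induction n with
  | zero =>
    have h0 : zigLayer L e 0 = 0 := by simp [zigLayer]
    have h0' : zigLayer L e (-0) = 0 := by simp [zigLayer]
    rw [Nat.cast_zero, h0, h0']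
    exact ⟨zero_mem_barlowLayer_zero' σ, zero_mem_barlowLayer_zero' σ⟩
  | succ n ih =>
    obtain ⟨ihf, ihb⟩ := ih
    constructor
    · -- forward
      show zigFwd L σ e n + modelStep L σ e (zigSlab L e n) ∈ _
      by_cases hs : 0 ≤ (L.symm e) 2
      · have hl : zigLayer L e n = n := by simp [zigLayer, hs]
        have hl' : zigLayer L e ((n + 1 : ℕ) : ℤ) = n + 1 := by simp [zigLayer, hs]
        have hsl : zigSlab L e n = n := by simp [zigSlab, hs]
        rw [hl] at ihf; rw [hl', hsl]
        exact (add_modelStep_mem_barlowLayer L hσ e n _).1 hs ihf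
      · have hl : zigLayer L e n = -n := by simp [zigLayer, hs]
        have hl' : zigLayer L e ((n + 1 : ℕ) : ℤ) = -(n + 1) := by simp [zigLayer, hs]
        have hsl : zigSlab L e n = -n - 1 := by simp [zigSlab, hs]
        rw [hl] at ihf; rw [hl', hsl]
        have h := (add_modelStep_mem_barlowLayer L hσ e (-n - 1) (zigFwd L σ e n)).2 hs
        rw [show (-(n : ℤ) - 1 + 1) = -n by ring] at h
        rw [show (-((n : ℤ) + 1)) = -n - 1 by ring]
        exact h ihf
    · -- backward
      show zigBwd L σ e n - modelStep L σ e (zigSlab L e (-((n : ℤ) + 1))) ∈ _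
      by_cases hs : 0 ≤ (L.symm e) 2
      · have hl : zigLayer L e (-(n : ℤ)) = -n := by simp [zigLayer, hs]
        have hl' : zigLayer L e (-((n + 1 : ℕ) : ℤ)) = -(n + 1) := by simp [zigLayer, hs]
        have hsl : zigSlab L e (-((n : ℤ) + 1)) = -(n + 1) := by simp [zigSlab, hs]
        rw [hl] at ihb; rw [hl', hsl]
        have h := (sub_modelStep_mem_barlowLayer L hσ e (-((n : ℤ) + 1)) (zigBwd L σ e n)).1 hs
        rw [show (-((n : ℤ) + 1) + 1) = -n by ring] at h
        exact h ihb
      · have hl : zigLayer L e (-(n : ℤ)) = n := by simp [zigLayer, hs]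
        have hl' : zigLayer L e (-((n + 1 : ℕ) : ℤ)) = n + 1 := by simp [zigLayer, hs]
        have hsl : zigSlab L e (-((n : ℤ) + 1)) = n := by simp [zigSlab, hs]
        rw [hl] at ihb; rw [hl', hsl]
        exact (sub_modelStep_mem_barlowLayer L hσ e n (zigBwd L σ e n)).2 hs ihb

include hσ in
/-- **Every vertex is a site of its layer.** -/
theorem zigVertex_mem_barlowLayer (k : ℤ) :
    zigVertex L σ e k ∈ barlowLayer 1 (Real.sqrt (2 / 3)) σ (zigLayer L e k) := by
  rcases le_or_gt 0 k with hk | hk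
  · obtain ⟨n, rfl⟩ := Int.eq_ofNat_of_zero_le hk
    simp only [zigVertex, Int.natCast_nonneg, if_true, Int.toNat_natCast]
    exact (zigFwd_zigBwd_mem L hσ e n).1
  · obtain ⟨n, rfl⟩ : ∃ n : ℕ, k = -(n : ℤ) := ⟨(-k).toNat, by omega⟩
    have h1 : ¬ (0 : ℤ) ≤ -(n : ℤ) := by omega
    simp only [zigVertex, h1, if_false, neg_neg, Int.toNat_natCast]
    exact (zigFwd_zigBwd_mem L hσ e n).2

/-- The model height of vertex `k`. -/
theorem zigVertex_apply_two {L : E3 ≃ₗᵢ[ℝ] E3} {σ : ℤ → ℤ} (hσ : IsHaggSeq σ) (e : E3) (k : ℤ) :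
    zigVertex L σ e k 2 = (zigLayer L e k : ℝ) * Real.sqrt (2 / 3) := by
  obtain ⟨x, y, h⟩ := zigVertex_mem_barlowLayer L hσ e k
  rw [h, barlowPos_apply_two]

include hσ in
/-- **The translates of the polyline by the layer lattice are sites**: `zigVertex k + t₀ u + t₁ v` is a site of layer
`zigLayer k`. -/
theorem zigVertex_add_lattice_mem (k : ℤ) (t : Fin 2 → ℤ) :
    zigVertex L σ e k + ((t 0 : ℝ) • triangularVec₁ 1 + (t 1 : ℝ) • triangularVec₂ 1) ∈
      barlowLayer 1 (Real.sqrt (2 / 3)) σ (zigLayer L e k) := by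
  obtain ⟨x, y, h⟩ := zigVertex_mem_barlowLayer L hσ e k
  refine ⟨x + t 0, y + t 1, ?_⟩
  rw [h]
  simp only [barlowPos]
  push_cast
  module

include hσ in
/-- In the cell: `L (zigVertex k + t₀ u + t₁ v) + s ∈ stacking L s σ`. -/
theorem zigVertex_add_lattice_mem_stacking (s : E3) (k : ℤ) (t : Fin 2 → ℤ) :
    L (zigVertex L σ e k + ((t 0 : ℝ) • triangularVec₁ 1 + (t 1 : ℝ) • triangularVec₂ 1)) + s ∈ stacking L s σ := by
  obtain ⟨x, y, h⟩ := zigVertex_add_lattice_mem L hσ e k t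
  exact ⟨_, ⟨zigLayer L e k, x, y, h⟩, rfl⟩

/-- The rise, length and model height of step `k`. -/
theorem zigStep_spec (σ : ℤ → ℤ) (k : ℤ) :
    ⟪zigStep L σ e k, L.symm e⟫_ℝ = bilayerRise L σ e (zigSlab L e k) ∧ ‖zigStep L σ e k‖ = 1 ∧
      zigStep L σ e k 2 = axisSign L e * Real.sqrt (2 / 3) :=
  ⟨inner_modelStep L σ e _, norm_modelStep L σ e _, modelStep_apply_two L σ e _⟩

end Sites

end Summit.Ventures.Crystal3D.Theorems

end
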